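import Summits.ValiantsHypothesis.ValiantsHypothesis.Theorems.GrenetZeonDualUnipotentThreeHalvesSlowCoreLedger

/-!
# GAUGE ROW for `GrenetZeon.DualUnipotentThreeHalves` (stmt-ValiantsHypothesis-24318) — the fourth ledger move and the cell's extremiser `W(m)`
# priced in the currency of (c) `LongMassSlowLaw` (val-idea-27 g7, lens (b) «representation-theoretic / weight», POWER currency)

Status.  VP≠VNP NOT proved.  Crux 24318 / S3 `SlowPlane` / R2ᵖ / IRR / RED / (c) `LongMassSlowLaw` OPEN.  This file asserts no law; everything below
is sorry-free kernel arithmetic about ONE family of pencils plus one certified ledger move.  Critic of record val-idea-crit-7 g3 (V27 pricing of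
`MassCut.lean`, val-idea-26 g5 @23:21Z); lead val-port-2 g3 (`slow_core` rev 2).  Cell datum used: CENSUS-EXTREMISERS X4 / ENGINE-iota §3 (eng-2's
family `W(m) = ℂ·J_m ⊕ 𝓛_h`, `ι(m) ≥ ⌊(m−1)²/4⌋+1`, «cube-zero ⇒ flag-cheap by the index certificate», «a general-m Lean proof of W(m) is a natural
port-seat target»), and `MassCut.lean` (a) `Ledger` / `RelCert` / (c) `LongMassSlowLaw` (price `≤ c·√n·b` for irreducible constituents).

## What is here (kernel, no `sorry`)
§1 `gauge_pow` — the SYMBOLIC GAUGE FORMULA in any algebra: `C² = 0`, `C X C = 0` ⇒ for every `L`,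
   `(a•X + [C,X])^(L+2) = a^L • (a²•X^(L+2) + a•[C, X^(L+2)] − C X^(L+2) C)`
   (for invertible `a` this is `g (aX)^{L+2} g⁻¹`, `g = 1 + C/a`; the point is that it holds with NO invertibility, so it prices the boundary `a = 0` too).
§2 the hook block `𝒳₁ = {rows ≥ h} × {cols ≤ h−2}` (0-indexed; `h = ⌊m/2⌋+1`), `J_m`, `𝒳₁·𝒳₁ = 0`, `𝒳₁ J 𝒳₁ = 0`, `J_m^m = 0`, and
   `gaugeMat a C := a•J + [C,J]`; ★ `gaugeMat_pow_eq_zero : gaugeMat a C ^ m = 0` for EVERY `m ≥ 2`, every `a`, every hook-supported `C`.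
   IDENTIFICATION (paper, three lines): `{gaugeMat a C} = ℂJ_m ⊕ [𝒳₁, J_m] = W(m)` of ENGINE-iota §3 — `[𝒳₁,J] ⊆ 𝓛_h` (support ⊆ B_h; the k-th
   subdiagonal sum of `[C,J]` is `tr([C,J]J^k) = 0`), `ad_J` is injective on `𝒳₁`, and `dim 𝒳₁ = (m − h)(h − 1) = dim 𝓛_h`.  So ★ is eng-2's
   nilpotency theorem for the extremiser family, all `m`, in kernel (the companion determinant replaced by the gauge formula).
§3 `gaugeMat_map` (ring homs), so line substitution commutes with the construction.
§4 THE ROW.  `gaugePencil ℓ Ĉ : AffMat n m := ℓ•J + [Ĉ,J]` for an affine form `ℓ` and an affine hook-supported `Ĉ` (any `n`, any `m ≥ 2`, any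
   coordinatisation — eng-2's `W(m)`-pencils are the case `ℓ = x₀`, `Ĉ` = the generic matrix of `𝒳₁`): `isAffine_gaugePencil`, `gaugePencil_pow_eq_zero`
   (`^m = 0`), and ★★ `ledger_gaugePencil : Ledger (gaugePencil ℓ Ĉ) ⊤ (frozenDir ℓ) 2` — along the hyperplane of directions that freeze `ℓ`
   (codim ≤ 1, `finrank_frozenDir`), EVERY power has `s`-degree ≤ 2 (§1 with `a = ℓ(x)` constant) — hence `relCert_gaugePencil : RelCert … (2n+1)`
   and `slowR_gaugePencil : 3n+1 < n² → SlowR`.  rev 2 (00:04Z, on ✓ p680269): `Ledger`/`RelCert` are the THEOREMS decls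
   `SlowCore.Ledger`/`SlowCore.RelCert` of `…Theorems.GrenetZeonDualUnipotentThreeHalvesSlowCoreLedger` BY NAME (val-port-2 g3's port of
   `MassCut` (a)); the rev-1 δ-twins are deleted, so r4 is directly consumable by LINE `slow_core` / the (c)-seat; `slow_gaugePencil'` via
   ✓ `SlowCore.slow_of_relCert`.
§5 `ledger_of_gauge` — the GAUGE MOVE as a certified ledger provider: if along every line of `K` the substituted pencil is `G·M·G'` with `G'G = 1`,
   `deg G ≤ d₁`, `deg G' ≤ d₂` (POLYNOMIAL gauge, not a constant change of basis) and the window powers of `M` have degree `≤ k₀`, then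
   `Ledger N ⊤ K (d₁ + k₀ + d₂)`.  FREEZE/ABSORB/STACK/LEVEL/FLAG (`MassCut` §1–§2, `slowR_of_flagCheap`) all conjugate by CONSTANTS.

## Why this is a row of (c) and what it shows (paper; MEMO-idea27-g7-weight-lens.md §1 has the proofs)
PRICES of `W(b)`-pencils (`b ≤ 2n`, irreducible by ENGINE-iota §3, index `b`) in (c)'s currency `n·k + codim K`:
FREEZE = mass `μ = dim W(b) = ⌊(b−1)²/4⌋+1 ≈ b²/4`; ABSORB = `n(b−1)`; every FLAG/WORD certificate (⊇ index-core, level, stack: `W(b)` is irreducible,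
there is no block structure to stack) costs `≥ min(1.5·n^{4/3}, 2n²/b) − O(n)` (corner-transfer lemma, memo §1: at the generic point the tops are
`[C,J]`, a word certificate of codimension `z` leaves the periodic words `(QJ^{e−2})^t`, `e ≤ √(2z)+2`, alive, forcing `k ≥ (n−1)/e − 1`; rigorous for
coordinate direction spaces, general `K` by torus reduction as in `NewtonPrice.TorusReduction`); GAUGE (this file) = `2n + 1`.
Hence in the window `4c√n < b < 1.5·n^{5/6}/c` (non-empty for `n > 20c⁶`) the entire certified menu of `MassCut.lean` + `PowerSieve.lean` +
`slowR_of_flagCheap` FAILS to pay `c·√n·b` on the irreducible constituent `W(b)`, while the gauge certificate pays `2n+1 ≤ c√n·b`.  (c) itself is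
NOT threatened (it asks for ∃ certificate); what is shown is that any PROOF CALCULUS for (c)/IRR built from constant-conjugation moves is incomplete
on the irreducible locus, and the missing primitive is §5.  In the absolute currency of R2ᵖ/S3 the same `W(b)` is flag-cheap (X4, idea-30 N4) — the
gauge-only phenomenon is visible only in the mass-relative currency the director made the research statement (R315 (3)(c)).
Honest limits: no irreducibility proof here (paper, ENGINE-iota §3; kernel instances ✓ p649884 `ι(5) ≥ 5`, ✓ p650615 `ι(6) ≥ 7`); the flag lower bound
is paper; nothing here bears on IRR/RED/(c) beyond supplying a row and a move.  VP≠VNP NOT proved.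
-/

-- single-conjunct layout: Sub = Summit, duplicated namespace component intended (the name is mandated)
set_option linter.dupNamespace false
set_option linter.unusedSimpArgs false
set_option autoImplicit false

noncomputable section

namespace Summit.ValiantsHypothesis.ValiantsHypothesis.Cruxes.DualUnipotentThreeHalves.GaugeRow

open MvPolynomial Matrix
open scoped BigOperators
open Summit.ValiantsHypothesis.ValiantsHypothesis.Cruxes.TwoDimCoefficients.DimTwoCases
  (AffMat IsAffine aeval_line_of_totalDegree_le_one totalDegree_aeval_line_le_one)
open Summit.ValiantsHypothesis.ValiantsHypothesis.Theorems.GrenetZeon.RadicalSplit (lineSubst FlagCheap pencilAlg)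
open Summit.ValiantsHypothesis.ValiantsHypothesis.Theorems.GrenetZeon.SlowCore (Slow SlowR slow_of_slowR Ledger RelCert slow_of_relCert)

/-! ## §1 The symbolic gauge formula -/

/-- ★ **SYMBOLIC GAUGE FORMULA.**  In any algebra: `C² = 0`, `C X C = 0` ⇒
`(a•X + [C,X])^(L+2) = a^L • (a²•X^(L+2) + a•[C, X^(L+2)] − C·X^(L+2)·C)` for every `L`.  (For invertible `a` this is conjugation of `(aX)^(L+2)`
by `g = 1 + C/a`, `g⁻¹ = 1 − C/a`; the identity needs no invertibility.) [val-idea-27 g7] -/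
theorem gauge_pow {R A : Type*} [CommRing R] [Ring A] [Algebra R A] (a : R) (X C : A)
    (hCC : C * C = 0) (hCXC : C * X * C = 0) (L : ℕ) :
    (a • X + (C * X - X * C)) ^ (L + 2)
      = a ^ L • (a ^ 2 • X ^ (L + 2) + a • (C * X ^ (L + 2) - X ^ (L + 2) * C) - C * X ^ (L + 2) * C) := by
  have hCXC' : C * (X * C) = 0 := by rw [← mul_assoc]; exact hCXC
  have hCCt : ∀ M : A, C * (C * M) = 0 := fun M => by rw [← mul_assoc, hCC, zero_mul]
  have hCXCt : ∀ M : A, C * (X * (C * M)) = 0 := fun M => by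
    rw [← mul_assoc, ← mul_assoc, hCXC, zero_mul]
  induction L with
  | zero =>
      simp only [pow_zero, pow_succ, one_mul, one_smul, add_mul, mul_add, sub_mul, mul_sub, smul_mul_assoc,
        mul_smul_comm, smul_add, smul_sub, smul_smul, mul_assoc, hCXC', hCCt, hCXCt, mul_zero,
        sub_zero, add_zero, zero_add]
      module
  | succ L ih =>
      rw [pow_succ, ih, show L + 1 + 2 = L + 2 + 1 from rfl, pow_succ X (L + 2)]
      set P := X ^ (L + 2) with hP
      simp only [pow_succ, add_mul, mul_add, sub_mul, mul_sub, smul_mul_assoc,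
        mul_smul_comm, smul_add, smul_sub, smul_smul, mul_assoc, hCXC', hCCt, mul_zero,
        smul_zero, sub_zero]
      module

/-- The square: `(a•X + [C,X])² = a²X² + a[C,X²] − C X² C`. -/
theorem gauge_sq {R A : Type*} [CommRing R] [Ring A] [Algebra R A] (a : R) (X C : A)
    (hCC : C * C = 0) (hCXC : C * X * C = 0) :
    (a • X + (C * X - X * C)) ^ 2 = a ^ 2 • X ^ 2 + a • (C * X ^ 2 - X ^ 2 * C) - C * X ^ 2 * C := by
  have h := gauge_pow a X C hCC hCXC 0
  rw [pow_zero, one_smul] at h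
  exact h

/-- Nilpotency is inherited: `X^(L+2) = 0 ⇒ (a•X + [C,X])^(L+2) = 0`. -/
theorem gauge_pow_eq_zero {R A : Type*} [CommRing R] [Ring A] [Algebra R A] (a : R) (X C : A)
    (hCC : C * C = 0) (hCXC : C * X * C = 0) (L : ℕ) (hX : X ^ (L + 2) = 0) :
    (a • X + (C * X - X * C)) ^ (L + 2) = 0 := by
  rw [gauge_pow a X C hCC hCXC L, hX]
  simp

/-! ## §2 The hook block `𝒳₁`, the Jordan block `J_m`, and `gaugeMat a C = a•J + [C,J]` (= eng-2's `W(m)`) -/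

variable {S T : Type*} {m : ℕ}

/-- `h(m) = ⌊m/2⌋ + 1` (ENGINE-iota §3). -/
def hk (m : ℕ) : ℕ := m / 2 + 1

/-- HOOK SUPPORT (0-indexed): `C i j ≠ 0 ⇒ i ≥ h ∧ j ≤ h − 2` — the block `𝒳₁` of rows `h+1..m` × columns `1..h−1` in ENGINE-iota's 1-indexed
coordinates; `[𝒳₁, J_m] = 𝓛_h`. -/
def HookSupp [Zero S] (C : Matrix (Fin m) (Fin m) S) : Prop :=
  ∀ i j, C i j ≠ 0 → hk m ≤ (i : ℕ) ∧ (j : ℕ) + 2 ≤ hk m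

/-- `J_m = Σ_s E_{s,s+1}` over any semiring. -/
def Jm (m : ℕ) [Zero S] [One S] : Matrix (Fin m) (Fin m) S := fun i j => if (j : ℕ) = (i : ℕ) + 1 then 1 else 0

/-- `𝒳₁ · 𝒳₁ = 0`. -/
theorem hook_mul_hook [Ring S] {C C' : Matrix (Fin m) (Fin m) S} (hC : HookSupp C) (hC' : HookSupp C') : C * C' = 0 := by
  ext i j
  rw [Matrix.mul_apply, Matrix.zero_apply]
  refine Finset.sum_eq_zero fun k _ => ?_
  by_cases h1 : C i k = 0
  · rw [h1, zero_mul]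
  by_cases h2 : C' k j = 0
  · rw [h2, mul_zero]
  have e1 := (hC i k h1).2
  have e2 := (hC' k j h2).1
  omega

/-- `𝒳₁ · J · 𝒳₁ = 0`. -/
theorem hook_J_hook [Ring S] {C C' : Matrix (Fin m) (Fin m) S} (hC : HookSupp C) (hC' : HookSupp C') :
    C * (Jm m * C') = 0 := by
  ext i j
  rw [Matrix.mul_apply, Matrix.zero_apply]
  refine Finset.sum_eq_zero fun k _ => ?_
  by_cases h1 : C i k = 0
  · rw [h1, zero_mul]
  have hk2 := (hC i k h1).2
  suffices h : (Jm m * C' : Matrix (Fin m) (Fin m) S) k j = 0 by rw [h, mul_zero]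
  rw [Matrix.mul_apply]
  refine Finset.sum_eq_zero fun l _ => ?_
  by_cases h3 : C' l j = 0
  · rw [h3, mul_zero]
  have hl := (hC' l j h3).1
  have hJ : (Jm m : Matrix (Fin m) (Fin m) S) k l = 0 := by
    simp only [Jm]
    rw [if_neg]
    omega
  rw [hJ, zero_mul]

/-- Support of the powers of `J_m`: `(J^k) i j ≠ 0 ⇒ j = i + k`. -/
theorem Jm_pow_apply_ne_zero [Ring S] (k : ℕ) :
    ∀ i j : Fin m, ((Jm m : Matrix (Fin m) (Fin m) S) ^ k) i j ≠ 0 → (j : ℕ) = (i : ℕ) + k := by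
  induction k with
  | zero =>
      intro i j h
      rw [pow_zero, Matrix.one_apply] at h
      by_cases e : i = j
      · subst e; simp
      · exact absurd (if_neg e) h
  | succ k ih =>
      intro i j h
      rw [pow_succ, Matrix.mul_apply] at h
      obtain ⟨l, _, hl⟩ := Finset.exists_ne_zero_of_sum_ne_zero h
      have h1 : ((Jm m : Matrix (Fin m) (Fin m) S) ^ k) i l ≠ 0 := left_ne_zero_of_mul hl
      have h2 : (Jm m : Matrix (Fin m) (Fin m) S) l j ≠ 0 := right_ne_zero_of_mul hl
      have e1 := ih i l h1
      have e2 : (j : ℕ) = (l : ℕ) + 1 := by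
        simp only [Jm] at h2
        by_contra hne
        exact h2 (if_neg hne)
      omega

/-- `J_m ^ m = 0`. -/
theorem Jm_pow_eq_zero [Ring S] : ((Jm m : Matrix (Fin m) (Fin m) S)) ^ m = 0 := by
  ext i j
  rw [Matrix.zero_apply]
  by_contra h
  have e := Jm_pow_apply_ne_zero m i j h
  have := j.isLt
  omega

/-- **`gaugeMat a C = a•J_m + [C, J_m]`** — for hook-supported `C` these are exactly the members of eng-2's `W(m) = ℂJ_m ⊕ 𝓛_h` (X4). -/
def gaugeMat [CommRing S] (a : S) (C : Matrix (Fin m) (Fin m) S) : Matrix (Fin m) (Fin m) S :=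
  a • Jm m + (C * Jm m - Jm m * C)

/-- The gauge formula for `W(m)`: every power of `a•J + [C,J]` is `a^L•(a²J^{L+2} + a[C,J^{L+2}] − C J^{L+2} C)`. -/
theorem gaugeMat_pow [CommRing S] (a : S) {C : Matrix (Fin m) (Fin m) S} (hC : HookSupp C) (L : ℕ) :
    gaugeMat a C ^ (L + 2) = a ^ L • (a ^ 2 • (Jm m) ^ (L + 2) + a • (C * (Jm m) ^ (L + 2) - (Jm m) ^ (L + 2) * C)
      - C * (Jm m) ^ (L + 2) * C) :=
  gauge_pow a (Jm m) C (hook_mul_hook hC hC) (by rw [Matrix.mul_assoc]; exact hook_J_hook hC hC) L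

/-- ★ **eng-2's nilpotency theorem for the extremiser family, all `m`** (ENGINE-iota §3, port target): `(a•J_m + [C,J_m])^m = 0` for every `m ≥ 2`,
every scalar `a` and every hook-supported `C`, over any commutative ring. -/
theorem gaugeMat_pow_eq_zero [CommRing S] (a : S) {C : Matrix (Fin m) (Fin m) S} (hC : HookSupp C) (hm : 2 ≤ m) :
    gaugeMat a C ^ m = 0 := by
  obtain ⟨L, rfl⟩ : ∃ L, m = L + 2 := ⟨m - 2, by omega⟩
  rw [gaugeMat_pow a hC L, Jm_pow_eq_zero]
  simp

/-! ## §3 Functoriality (line substitution commutes with the construction) -/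

theorem HookSupp.map [Zero S] [Zero T] {C : Matrix (Fin m) (Fin m) S} (hC : HookSupp C) (f : S → T) (hf : f 0 = 0) :
    HookSupp (C.map f) :=
  fun i j h => hC i j (fun h0 => h (by rw [Matrix.map_apply, h0, hf]))

theorem Jm_map [Semiring S] [Semiring T] (f : S →+* T) : (Jm m : Matrix (Fin m) (Fin m) S).map f = Jm m := by
  ext i j
  simp only [Matrix.map_apply, Jm]
  split_ifs <;> simp

theorem gaugeMat_map [CommRing S] [CommRing T] (f : S →+* T) (a : S) (C : Matrix (Fin m) (Fin m) S) :
    (gaugeMat a C).map f = gaugeMat (f a) (C.map f) := by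
  have hJ : (Jm m : Matrix (Fin m) (Fin m) S).map f = Jm m := Jm_map f
  have hs : (a • (Jm m : Matrix (Fin m) (Fin m) S)).map f = f a • (Jm m : Matrix (Fin m) (Fin m) T) := by
    ext i j
    have e := congr_fun (congr_fun hJ i) j
    rw [Matrix.map_apply] at e
    rw [Matrix.map_apply, Matrix.smul_apply, Matrix.smul_apply, smul_eq_mul, smul_eq_mul, map_mul, e]
  rw [show (gaugeMat a C).map f = f.mapMatrix (gaugeMat a C) from rfl, gaugeMat, map_add, map_sub, map_mul, map_mul]
  simp only [RingHom.mapMatrix_apply, hJ, hs]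
  rfl

/-! ## §4 The row: `gaugePencil ℓ Ĉ` and its ledger along the hyperplane freezing `ℓ` -/

variable {n : ℕ}

/-- The coefficient of `s` in `ℓ(x + s v)` for an affine `ℓ`: `Σ_c v_c · [x_c]ℓ`. -/
def linCoeff (ℓ : MvPolynomial (Fin n × Fin n) ℂ) (v : Fin n × Fin n → ℂ) : ℂ :=
  ∑ c, v c * coeff (Finsupp.single c 1) ℓ

/-- … as a linear form on directions. -/
def linForm (ℓ : MvPolynomial (Fin n × Fin n) ℂ) : (Fin n × Fin n → ℂ) →ₗ[ℂ] ℂ where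
  toFun v := linCoeff ℓ v
  map_add' u w := by
    simp only [linCoeff, Pi.add_apply, add_mul, Finset.sum_add_distrib]
  map_smul' r u := by
    simp only [linCoeff, Pi.smul_apply, smul_eq_mul, RingHom.id_apply, Finset.mul_sum, mul_assoc]

/-- The direction hyperplane FREEZING `ℓ`. -/
def frozenDir (ℓ : MvPolynomial (Fin n × Fin n) ℂ) : Submodule ℂ (Fin n × Fin n → ℂ) := LinearMap.ker (linForm ℓ)

/-- `codim (frozenDir ℓ) ≤ 1`. -/
theorem finrank_frozenDir (ℓ : MvPolynomial (Fin n × Fin n) ℂ) : n * n ≤ Module.finrank ℂ (frozenDir ℓ) + 1 := by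
  have h := LinearMap.finrank_range_add_finrank_ker (linForm ℓ)
  have hr : Module.finrank ℂ (LinearMap.range (linForm ℓ)) ≤ 1 := by
    calc Module.finrank ℂ (LinearMap.range (linForm ℓ)) ≤ Module.finrank ℂ ℂ := Submodule.finrank_le _
      _ = 1 := Module.finrank_self ℂ
  have hV : Module.finrank ℂ (Fin n × Fin n → ℂ) = n * n := by
    rw [Module.finrank_pi, Fintype.card_prod, Fintype.card_fin]
  rw [frozenDir]
  omega

/-- An affine polynomial along a line: `ℓ(x + s v) = ℓ(x) + linCoeff ℓ v · s`. -/
theorem lineSubst_of_affine (x v : Fin n × Fin n → ℂ) {g : MvPolynomial (Fin n × Fin n) ℂ} (hg : g.totalDegree ≤ 1) :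
    lineSubst x v g = C (eval x g) + C (linCoeff g v) * X 0 := by
  rw [show lineSubst x v = aeval (fun c => (C (x c) + ∑ t : Fin (0 + 1), C ((fun _ : Fin (0 + 1) => v) t c) * X t :
      MvPolynomial (Fin (0 + 1)) ℂ)) from rfl, aeval_line_of_totalDegree_le_one x (fun _ : Fin (0 + 1) => v) hg]
  simp only [Fin.sum_univ_succ, Fin.sum_univ_zero, add_zero, linCoeff]

/-- Along a frozen direction `ℓ(x + s v) = ℓ(x)` is a constant. -/
theorem lineSubst_of_frozen (x v : Fin n × Fin n → ℂ) {ℓ : MvPolynomial (Fin n × Fin n) ℂ} (hℓ : ℓ.totalDegree ≤ 1)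
    (hv : v ∈ frozenDir ℓ) : lineSubst x v ℓ = C (eval x ℓ) := by
  have hz : linCoeff ℓ v = 0 := hv
  rw [lineSubst_of_affine x v hℓ, hz, C_0, zero_mul, add_zero]

/-- Affine entries stay affine along a line (Theorems-side twin). -/
theorem totalDegree_lineSubst_le_one (x v : Fin n × Fin n → ℂ) {g : MvPolynomial (Fin n × Fin n) ℂ} (hg : g.totalDegree ≤ 1) :
    (lineSubst x v g).totalDegree ≤ 1 :=
  totalDegree_aeval_line_le_one x (fun _ : Fin (0 + 1) => v) hg

/-- **THE ROW.**  `gaugePencil ℓ Ĉ = ℓ•J_m + [Ĉ, J_m]` (eng-2's `W(m)`-pencils: `ℓ = x₀`, `Ĉ` = the generic matrix of `𝒳₁`). -/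
def gaugePencil (ℓ : MvPolynomial (Fin n × Fin n) ℂ) (Ĉ : AffMat n m) : AffMat n m := gaugeMat ℓ Ĉ

section DegreeBookkeeping

variable {σ : Type*}

theorem totalDegree_Jm_apply (i j : Fin m) : ((Jm m : Matrix (Fin m) (Fin m) (MvPolynomial σ ℂ)) i j).totalDegree = 0 := by
  simp only [Jm]
  split_ifs <;> simp

theorem totalDegree_Jm_pow_apply (k : ℕ) (i j : Fin m) :
    (((Jm m : Matrix (Fin m) (Fin m) (MvPolynomial σ ℂ)) ^ k) i j).totalDegree = 0 := by
  rw [← Jm_map (C : ℂ →+* MvPolynomial σ ℂ),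
    show (Jm m : Matrix (Fin m) (Fin m) ℂ).map (C : ℂ →+* MvPolynomial σ ℂ) = (C : ℂ →+* MvPolynomial σ ℂ).mapMatrix (Jm m) from rfl,
    ← map_pow]
  simp [RingHom.mapMatrix_apply, Matrix.map_apply]

theorem totalDegree_mul_apply_le {M N : Matrix (Fin m) (Fin m) (MvPolynomial σ ℂ)} {d₁ d₂ : ℕ}
    (hM : ∀ i j, (M i j).totalDegree ≤ d₁) (hN : ∀ i j, (N i j).totalDegree ≤ d₂) (i j : Fin m) :
    ((M * N) i j).totalDegree ≤ d₁ + d₂ := by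
  rw [Matrix.mul_apply]
  refine (totalDegree_finsetSum _ _).trans (Finset.sup_le fun k _ => ?_)
  exact (totalDegree_mul _ _).trans (Nat.add_le_add (hM i k) (hN k j))

theorem totalDegree_add_apply_le {M N : Matrix (Fin m) (Fin m) (MvPolynomial σ ℂ)} {d : ℕ}
    (hM : ∀ i j, (M i j).totalDegree ≤ d) (hN : ∀ i j, (N i j).totalDegree ≤ d) (i j : Fin m) :
    ((M + N) i j).totalDegree ≤ d := by
  rw [Matrix.add_apply]
  exact (totalDegree_add _ _).trans (max_le (hM i j) (hN i j))

theorem totalDegree_sub_apply_le {M N : Matrix (Fin m) (Fin m) (MvPolynomial σ ℂ)} {d : ℕ}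
    (hM : ∀ i j, (M i j).totalDegree ≤ d) (hN : ∀ i j, (N i j).totalDegree ≤ d) (i j : Fin m) :
    ((M - N) i j).totalDegree ≤ d := by
  rw [Matrix.sub_apply]
  exact (totalDegree_sub _ _).trans (max_le (hM i j) (hN i j))

theorem totalDegree_smul_apply_le {M : Matrix (Fin m) (Fin m) (MvPolynomial σ ℂ)} {a : MvPolynomial σ ℂ} {d₀ d : ℕ}
    (ha : a.totalDegree ≤ d₀) (hM : ∀ i j, (M i j).totalDegree ≤ d) (i j : Fin m) :
    ((a • M) i j).totalDegree ≤ d₀ + d := by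
  rw [Matrix.smul_apply, smul_eq_mul]
  exact (totalDegree_mul _ _).trans (Nat.add_le_add ha (hM i j))

/-- Entries of `a•J + [C,J]` have degree `≤ max(deg a, deg C)`. -/
theorem totalDegree_gaugeMat_apply_le {a : MvPolynomial σ ℂ} {C' : Matrix (Fin m) (Fin m) (MvPolynomial σ ℂ)} {d : ℕ}
    (ha : a.totalDegree ≤ d) (hC : ∀ i j, (C' i j).totalDegree ≤ d) (i j : Fin m) :
    ((gaugeMat a C') i j).totalDegree ≤ d := by
  have hJ : ∀ i j, ((Jm m : Matrix (Fin m) (Fin m) (MvPolynomial σ ℂ)) i j).totalDegree ≤ 0 :=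
    fun i j => (totalDegree_Jm_apply i j).le
  unfold gaugeMat
  refine totalDegree_add_apply_le (d := d) ?_ ?_ i j
  · intro i j; simpa using totalDegree_smul_apply_le ha hJ i j
  · refine totalDegree_sub_apply_le ?_ ?_
    · intro i j; simpa using totalDegree_mul_apply_le hC hJ i j
    · intro i j; simpa using totalDegree_mul_apply_le hJ hC i j

end DegreeBookkeeping

/-- `gaugePencil ℓ Ĉ` is an affine pencil. -/
theorem isAffine_gaugePencil {ℓ : MvPolynomial (Fin n × Fin n) ℂ} {Ĉ : AffMat n m} (hℓ : ℓ.totalDegree ≤ 1) (hĈ : IsAffine Ĉ) :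
    IsAffine (gaugePencil ℓ Ĉ) :=
  fun i j => totalDegree_gaugeMat_apply_le hℓ hĈ i j

/-- `gaugePencil ℓ Ĉ` is nilpotent of index `≤ m` as a polynomial matrix (`m ≥ 2`). -/
theorem gaugePencil_pow_eq_zero (ℓ : MvPolynomial (Fin n × Fin n) ℂ) {Ĉ : AffMat n m} (hĈ : HookSupp Ĉ) (hm : 2 ≤ m) :
    gaugePencil ℓ Ĉ ^ m = 0 :=
  gaugeMat_pow_eq_zero ℓ hĈ hm

/-- Line substitution commutes with the construction. -/
theorem gaugePencil_map_lineSubst (ℓ : MvPolynomial (Fin n × Fin n) ℂ) (Ĉ : AffMat n m) (x v : Fin n × Fin n → ℂ) :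
    (gaugePencil ℓ Ĉ).map (lineSubst x v) = gaugeMat (lineSubst x v ℓ) (Ĉ.map (lineSubst x v)) :=
  gaugeMat_map (lineSubst x v).toRingHom ℓ Ĉ

-- rev 2: `Ledger` / `RelCert` are ✓ p680269 `Theorems.…SlowCoreLedger`'s `SlowCore.Ledger` / `SlowCore.RelCert` BY NAME (the δ-twins are gone).

/-- ★★ **THE GAUGE CERTIFICATE of `W(m)`**: along the hyperplane of directions freezing `ℓ`, EVERY power of the substituted pencil has `s`-degree
`≤ 2` — at every point, including the boundary `ℓ(x) = 0` (no case split: §1 with the constant `a = ℓ(x)`). -/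
theorem ledger_gaugePencil {ℓ : MvPolynomial (Fin n × Fin n) ℂ} {Ĉ : AffMat n m} (hℓ : ℓ.totalDegree ≤ 1) (hĈa : IsAffine Ĉ)
    (hĈ : HookSupp Ĉ) : Ledger n m (gaugePencil ℓ Ĉ) (fun _ => True) (frozenDir ℓ) 2 := by
  intro x v hv b _ i j _ _
  rw [gaugePencil_map_lineSubst, lineSubst_of_frozen x v hℓ hv]
  set a : MvPolynomial (Fin 1) ℂ := C (eval x ℓ) with ha_def
  set C' : Matrix (Fin m) (Fin m) (MvPolynomial (Fin 1) ℂ) := Ĉ.map (lineSubst x v) with hC'_def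
  have ha : a.totalDegree ≤ 0 := (totalDegree_C _).le
  have hC'1 : ∀ i j, (C' i j).totalDegree ≤ 1 := fun i j => by
    rw [hC'_def, Matrix.map_apply]; exact totalDegree_lineSubst_le_one x v (hĈa i j)
  have hC's : HookSupp C' := hĈ.map _ (map_zero _)
  have hJ0 : ∀ k (i j : Fin m), (((Jm m : Matrix (Fin m) (Fin m) (MvPolynomial (Fin 1) ℂ)) ^ k) i j).totalDegree ≤ 0 :=
    fun k i j => (totalDegree_Jm_pow_apply k i j).le
  rcases Nat.lt_or_ge b 2 with hb | hb
  · interval_cases b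
    · rw [pow_zero, Matrix.one_apply]
      split_ifs <;> simp
    · rw [pow_one]
      exact (totalDegree_gaugeMat_apply_le (d := 1) (ha.trans zero_le_one) hC'1 i j).trans one_le_two
  · obtain ⟨L, rfl⟩ : ∃ L, b = L + 2 := ⟨b - 2, by omega⟩
    rw [gaugeMat_pow a hC's L]
    have haL : (a ^ L).totalDegree ≤ 0 := (totalDegree_pow _ _).trans (by rw [ha_def, totalDegree_C, mul_zero])
    have ha2 : (a ^ 2).totalDegree ≤ 0 := (totalDegree_pow _ _).trans (by rw [ha_def, totalDegree_C, mul_zero])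
    set P := (Jm m : Matrix (Fin m) (Fin m) (MvPolynomial (Fin 1) ℂ)) ^ (L + 2) with hP
    have hP0 : ∀ i j, (P i j).totalDegree ≤ 0 := hJ0 (L + 2)
    -- degrees: a²•P : 0;  a•(C'P − PC') : 1;  C'PC' : 2
    have h1 : ∀ i j, ((a ^ 2 • P) i j).totalDegree ≤ 2 := fun i j =>
      (totalDegree_smul_apply_le ha2 hP0 i j).trans (by norm_num)
    have h2 : ∀ i j, ((a • (C' * P - P * C')) i j).totalDegree ≤ 2 := fun i j => by
      have hin : ∀ i j, ((C' * P - P * C') i j).totalDegree ≤ 1 :=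
        totalDegree_sub_apply_le (fun i j => by simpa using totalDegree_mul_apply_le hC'1 hP0 i j)
          (fun i j => by simpa using totalDegree_mul_apply_le hP0 hC'1 i j)
      exact (totalDegree_smul_apply_le ha hin i j).trans (by norm_num)
    have h3 : ∀ i j, ((C' * P * C') i j).totalDegree ≤ 2 := fun i j => by
      have := totalDegree_mul_apply_le (fun i j => totalDegree_mul_apply_le hC'1 hP0 i j) hC'1 i j
      simpa using this
    have h4 : ∀ i j, ((a ^ 2 • P + a • (C' * P - P * C') - C' * P * C') i j).totalDegree ≤ 2 :=
      totalDegree_sub_apply_le (totalDegree_add_apply_le h1 h2) h3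
    exact (totalDegree_smul_apply_le haL h4 i j).trans (by norm_num)

/-- **PRICE `2n + 1`** for every `W(m)`-type pencil (vs FREEZE `≈ b²/4`, ABSORB `n(b−1)`, FLAG `≥ min(1.5n^{4/3}, 2n²/b)` on `W(b)`). -/
theorem relCert_gaugePencil {ℓ : MvPolynomial (Fin n × Fin n) ℂ} {Ĉ : AffMat n m} (hℓ : ℓ.totalDegree ≤ 1) (hĈa : IsAffine Ĉ)
    (hĈ : HookSupp Ĉ) : RelCert n m (gaugePencil ℓ Ĉ) (2 * n + 1) := by
  refine ⟨frozenDir ℓ, 2, ledger_gaugePencil hℓ hĈa hĈ, ?_⟩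
  have := finrank_frozenDir ℓ
  omega

/-- In window currency: `W(m)`-type pencils are `SlowR` as soon as `3n + 1 < n²` (i.e. `n ≥ 4`), for EVERY format `m ≥ 2`. -/
theorem slowR_gaugePencil {ℓ : MvPolynomial (Fin n × Fin n) ℂ} {Ĉ : AffMat n m} (hℓ : ℓ.totalDegree ≤ 1) (hĈa : IsAffine Ĉ)
    (hĈ : HookSupp Ĉ) (hn : 3 * n + 1 < n * n) : SlowR n m (gaugePencil ℓ Ĉ) := by
  refine ⟨frozenDir ℓ, 2, fun x v hv b hb i j => ledger_gaugePencil hℓ hĈa hĈ x v hv b hb i j trivial trivial, ?_⟩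
  have := finrank_frozenDir ℓ
  omega

theorem slow_gaugePencil {ℓ : MvPolynomial (Fin n × Fin n) ℂ} {Ĉ : AffMat n m} (hℓ : ℓ.totalDegree ≤ 1) (hĈa : IsAffine Ĉ)
    (hĈ : HookSupp Ĉ) (hn : 3 * n + 1 < n * n) : Slow n m (gaugePencil ℓ Ĉ) :=
  slow_of_slowR (slowR_gaugePencil hℓ hĈa hĈ hn)

/-- The same through the THEOREMS bridge ✓ `SlowCore.slow_of_relCert` (by-name sanity: r4's `RelCert` is the line's `RelCert`). -/
theorem slow_gaugePencil' {ℓ : MvPolynomial (Fin n × Fin n) ℂ} {Ĉ : AffMat n m} (hℓ : ℓ.totalDegree ≤ 1) (hĈa : IsAffine Ĉ)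
    (hĈ : HookSupp Ĉ) (hn : 3 * n + 1 < n * n) : Slow n m (gaugePencil ℓ Ĉ) :=
  slow_of_relCert (relCert_gaugePencil hℓ hĈa hĈ) (by omega)

/-! ## §5 The GAUGE MOVE as a certified ledger provider (the primitive missing from FREEZE · ABSORB · STACK · LEVEL · FLAG) -/

/-- Powers of a polynomial-gauge conjugate: `G'G = 1 ⇒ (G M G')^b = G M^b G'` for `b ≥ 1`; with `b = 0` both sides differ (`1` vs `GG'`), so the
move below treats `b = 0` separately. [folklore] -/
theorem conj_pow_succ {R : Type*} [Semiring R] (G G' M : Matrix (Fin m) (Fin m) R) (hGG : G' * G = 1) :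
    ∀ b : ℕ, (G * M * G') ^ (b + 1) = G * M ^ (b + 1) * G' := by
  intro b
  induction b with
  | zero => rw [zero_add, pow_one, pow_one]
  | succ b ih =>
      rw [pow_succ, ih]
      calc G * M ^ (b + 1) * G' * (G * M * G') = G * M ^ (b + 1) * (G' * G) * M * G' := by
            simp only [Matrix.mul_assoc]
        _ = G * M ^ (b + 1 + 1) * G' := by rw [hGG, Matrix.mul_one, pow_succ M (b + 1)]; simp only [Matrix.mul_assoc]

/-- ★ **GAUGE MOVE.**  If along every line of `K` the substituted pencil is `G · M · G'` with `G'G = 1`, `deg G ≤ d₁`, `deg G' ≤ d₂` (an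
`s`-POLYNOMIAL gauge) and the window powers of `M` have `s`-degree `≤ k₀`, then the pencil has ledger `d₁ + k₀ + d₂` on `K`.  (`W(m)` at a point with
`ℓ(x) ≠ 0`: `G = 1 + C'_s/ℓ(x)`, `G' = 1 − C'_s/ℓ(x)`, `M = ℓ(x)·J` constant, `(d₁, k₀, d₂) = (1, 0, 1)`.)  Every move of `MassCut.lean` §1–§2 and
`slowR_of_flagCheap` conjugates by CONSTANT matrices (`d₁ = d₂ = 0`). [val-idea-27 g7] -/
theorem ledger_of_gauge (N : AffMat n m) (K : Submodule ℂ (Fin n × Fin n → ℂ)) (d₁ k₀ d₂ : ℕ)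
    (h : ∀ x v : Fin n × Fin n → ℂ, v ∈ K →
      ∃ G G' M : Matrix (Fin m) (Fin m) (MvPolynomial (Fin 1) ℂ),
        G' * G = 1 ∧ N.map (lineSubst x v) = G * M * G' ∧
        (∀ i j, (G i j).totalDegree ≤ d₁) ∧ (∀ i j, (G' i j).totalDegree ≤ d₂) ∧
        (∀ b, b ≤ n - 1 → ∀ i j, ((M ^ b) i j).totalDegree ≤ k₀)) :
    Ledger n m N (fun _ => True) K (d₁ + k₀ + d₂) := by
  intro x v hv b hb i j _ _
  obtain ⟨G, G', M, hGG, hN, hG, hG', hM⟩ := h x v hv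
  rcases Nat.eq_zero_or_pos b with rfl | hpos
  · rw [pow_zero, Matrix.one_apply]
    split_ifs <;> simp
  · obtain ⟨b, rfl⟩ : ∃ b', b = b' + 1 := ⟨b - 1, by omega⟩
    rw [hN, conj_pow_succ G G' M hGG b]
    exact totalDegree_mul_apply_le (totalDegree_mul_apply_le hG (hM (b + 1) hb)) hG' i j

end Summit.ValiantsHypothesis.ValiantsHypothesis.Cruxes.DualUnipotentThreeHalves.GaugeRow

end
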